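import Literature.Barriers.Parity.SiegelZeroDichotomyChowla
import Literature.NumberTheory.LFunctions.SiegelZeroExceptionalPrimes
import Mathlib.NumberTheory.PrimeCounting
import Mathlib.Data.Nat.Factorization.Basic
import HarnessLib

/-!
# Step (i) of Tao–Teräväinen at `k = 0`, combinatorial part: Lemma 4.1 and the count of the
# integers where `λ` and its Siegel model differ

Topic `Literature/Barriers/Parity`, sub-namespace `TaoTeravainen`; second file of the proof DAG of
`Literature.Barriers.Parity.TaoTeravainen2021_chowla` (see `SiegelZeroDichotomyChowla.lean`). Towards
the named fact `TaoTeravainen2021_prop42_k0` (Proposition 4.2 at `k = 0`: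
`𝔼_{n ≤ x} ∏ⱼ λ(n+h'ⱼ) ≈ 𝔼_{n ≤ x} ∏ⱼ λ_Siegel(n+h'ⱼ)`) this file proves the pointwise and
counting statements of §4 that do not involve the exceptional zero; everything here is PROVED:

* `abs_prod_sub_prod_le` — `|∏ aᵢ - ∏ bᵢ| ≤ ∑ |aᵢ - bᵢ|` for `1`-bounded reals ("From (4.2) and the
  triangle inequality, it suffices to show that `𝔼 … |λ(n+h'_{j'}) - λ_Siegel(n+h'_{j'})| ≈ 0` for
  each `j'`");
* `liouville_eq_liouvilleSiegel_of` / `exists_excPrime_of_ne` — **Lemma 4.1 at `k = 0`**: "If `n` is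
  not divisible by any exceptional prime `p* > R`, then we have `λ(n) = λ_Siegel(n)` since
  `λ, λ_Siegel` agree on every prime dividing `n`"; hence `λ(n) ≠ λ_Siegel(n)` forces an exceptional
  prime `p* > R` (i.e. `χ(p*) ≠ -1`) dividing `n`, and `|λ(n) - λ_Siegel(n)| ≤ 2` by (4.2);
* `card_filter_ne_le` — the count behind (4.4)–(4.5) at `k = 0`: for `1 ≤ R`, `h ≤ x`,
  `#{n ≤ x : λ(n+h) ≠ λ_Siegel(n+h)} ≤ ∑_{R < p* ≤ x/R} (x/p* + 1) + ∑_{d ≤ 2R} π((x+h)/d)`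
  (an exceptional `p* ∣ n+h` with `R < p* ≤ x/R` puts `n` among the `≤ x/p* + 1` solutions of
  `p* ∣ n + h`; one with `p* > x/R` writes `n + h = d p*` with `d < 2R`, and for fixed `d` the map
  `n ↦ (n+h)/d` is injective into the primes `≤ (x+h)/d` — the source's "`n = p* d` for some
  `d ≤ 2R`. Since `n/d = p* ≥ x/R` is prime, the second term … is at least one").
  [cite: TaoTeravainen2021, §4, Lemma 4.1 and the reduction to (4.4), (4.5)]

The analytic part (Corollary 3.6 for `∑ 1/p*`, Chebyshev's bound for `π`, Siegel's theorem for the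
size of `q_χ`, and the assembly of `TaoTeravainen2021_prop42_k0`) is in the sequel
`SiegelZeroDichotomyChowlaStep1.lean`.
-/

noncomputable section

open Finset
open Literature.NumberTheory.LFunctions.SiegelZero (excPrimes mem_excPrimes)

namespace Literature.Barriers.Parity.TaoTeravainen

/-! ### Products of `1`-bounded reals -/

/-- `|∏ aᵢ - ∏ bᵢ| ≤ ∑ |aᵢ - bᵢ|` when `|aᵢ|, |bᵢ| ≤ 1`. [folklore] -/
theorem abs_prod_sub_prod_le {ι : Type*} (s : Finset ι) {a b : ι → ℝ}
    (ha : ∀ i ∈ s, |a i| ≤ 1) (hb : ∀ i ∈ s, |b i| ≤ 1) :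
    |∏ i ∈ s, a i - ∏ i ∈ s, b i| ≤ ∑ i ∈ s, |a i - b i| := by
  classical
  induction s using Finset.induction_on with
  | empty => simp
  | insert j s hj ih =>
    rw [Finset.prod_insert hj, Finset.prod_insert hj, Finset.sum_insert hj]
    have ha' : ∀ i ∈ s, |a i| ≤ 1 := fun i hi => ha i (Finset.mem_insert_of_mem hi)
    have hb' : ∀ i ∈ s, |b i| ≤ 1 := fun i hi => hb i (Finset.mem_insert_of_mem hi)
    have hbj : |∏ i ∈ s, b i| ≤ 1 := by
      rw [Finset.abs_prod]
      exact Finset.prod_le_one (fun i _ => abs_nonneg _) hb'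
    have h : a j * ∏ i ∈ s, a i - b j * ∏ i ∈ s, b i
        = a j * (∏ i ∈ s, a i - ∏ i ∈ s, b i) + (a j - b j) * ∏ i ∈ s, b i := by ring
    calc |a j * ∏ i ∈ s, a i - b j * ∏ i ∈ s, b i|
        = |a j * (∏ i ∈ s, a i - ∏ i ∈ s, b i) + (a j - b j) * ∏ i ∈ s, b i| := by rw [h]
      _ ≤ |a j * (∏ i ∈ s, a i - ∏ i ∈ s, b i)| + |(a j - b j) * ∏ i ∈ s, b i| := abs_add_le _ _
      _ ≤ 1 * |∏ i ∈ s, a i - ∏ i ∈ s, b i| + |a j - b j| * 1 := by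
          rw [abs_mul, abs_mul]
          gcongr
          exact ha j (Finset.mem_insert_self j s)
      _ ≤ |a j - b j| + ∑ i ∈ s, |a i - b i| := by linarith [ih ha' hb']

/-! ### Lemma 4.1 at `k = 0` -/

/-- `λ(n) = (-1)^{Ω(n)}` as the product of `-1` over the prime factors of `n ≠ 0` with multiplicity.
[folklore] -/
theorem liouville_cast_eq_prod {n : ℕ} (hn : n ≠ 0) :
    (ArithmeticFunction.liouville n : ℝ) = (n.primeFactorsList.map fun _ : ℕ => (-1 : ℝ)).prod := by
  rw [ArithmeticFunction.liouville_apply hn, ArithmeticFunction.cardFactors_apply, List.map_const',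
    List.prod_replicate]
  push_cast
  rfl

/-- **Lemma 4.1 (case `k = 0`), agreement clause**: if every prime factor `p` of `n ≠ 0` has `p ≤ R`
or `χ(p) = -1`, then `λ(n) = λ_Siegel(n)` ("`λ, λ_Siegel` agree on every prime dividing `n`").
[cite: TaoTeravainen2021, Lemma 4.1 (proof, first case)] -/
theorem liouville_eq_liouvilleSiegel_of {q : ℕ} (χ : DirichletCharacter ℂ q) (R : ℝ) {n : ℕ}
    (hn : n ≠ 0) (h : ∀ p ∈ n.primeFactorsList, (p : ℝ) ≤ R ∨ realChar χ p = -1) :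
    (ArithmeticFunction.liouville n : ℝ) = liouvilleSiegel χ R n := by
  rw [liouville_cast_eq_prod hn, liouvilleSiegel]
  congr 1
  refine List.map_congr_left fun p hp => ?_
  rcases h p hp with hpR | hχ
  · rw [if_pos hpR]
  · split_ifs <;> simp [hχ]

/-- **Lemma 4.1 (case `k = 0`), exceptional clause**: if `λ(n) ≠ λ_Siegel(n)` (`n ≠ 0`) then `n` is
divisible by an exceptional prime `p* > R` (`χ(p*) ≠ -1`). [cite: TaoTeravainen2021, Lemma 4.1] -/
theorem exists_excPrime_of_ne {q : ℕ} (χ : DirichletCharacter ℂ q) (R : ℝ) {n : ℕ} (hn : n ≠ 0)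
    (hne : (ArithmeticFunction.liouville n : ℝ) ≠ liouvilleSiegel χ R n) :
    ∃ p : ℕ, p.Prime ∧ p ∣ n ∧ R < p ∧ χ (p : ZMod q) ≠ -1 := by
  by_contra hcon
  refine hne (liouville_eq_liouvilleSiegel_of χ R hn fun p hp => ?_)
  have hpp : p.Prime := Nat.prime_of_mem_primeFactorsList hp
  have hpn : p ∣ n := Nat.dvd_of_mem_primeFactorsList hp
  by_cases hpR : (p : ℝ) ≤ R
  · exact Or.inl hpR
  · right
    by_contra hχ
    exact hcon ⟨p, hpp, hpn, not_le.mp hpR, fun h => hχ (by simp [realChar, h])⟩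

/-- (4.2): `|λ(n) - λ_Siegel(n)| ≤ 2`. [cite: TaoTeravainen2021, §4 (4.2)] -/
theorem abs_liouville_sub_liouvilleSiegel_le_two {q : ℕ} (χ : DirichletCharacter ℂ q) (R : ℝ)
    (n : ℕ) : |(ArithmeticFunction.liouville n : ℝ) - liouvilleSiegel χ R n| ≤ 2 :=
  (abs_sub _ _).trans (by
    linarith [Literature.NumberTheory.Sieve.abs_liouville_le_one n, abs_liouvilleSiegel_le_one χ R n])

/-! ### Counting -/

/-- The solutions `1 ≤ n ≤ x` of `p ∣ n + h` number at most `x/p + 1`. [folklore] -/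
theorem card_filter_dvd_add_le (p x h : ℕ) (hp : 0 < p) :
    (#((Icc 1 x).filter fun n => p ∣ n + h) : ℝ) ≤ (x : ℝ) / p + 1 := by
  classical
  -- shift by `h`: an injection into the multiples of `p` in `(h, x + h]`
  have hinj : #((Icc 1 x).filter fun n => p ∣ n + h) ≤
      #(((Ioc 0 (x + h)).filter fun m => p ∣ m) \ ((Ioc 0 h).filter fun m => p ∣ m)) := by
    refine Finset.card_le_card_of_injOn (fun n => n + h) (fun n hn => ?_) (fun a _ b _ hab => by
      simpa using hab)
    rw [Finset.mem_coe, mem_filter, mem_Icc] at hn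
    simp only [Finset.mem_coe, mem_sdiff, mem_filter, mem_Ioc]
    exact ⟨⟨⟨by omega, by omega⟩, hn.2⟩, fun hh => by omega⟩
  have hsub : ((Ioc 0 h).filter fun m => p ∣ m) ⊆ ((Ioc 0 (x + h)).filter fun m => p ∣ m) := by
    intro m hm
    rw [mem_filter, mem_Ioc] at hm ⊢
    exact ⟨⟨hm.1.1, by omega⟩, hm.2⟩
  rw [Finset.card_sdiff_of_subset hsub, Nat.Ioc_filter_dvd_card_eq_div,
    Nat.Ioc_filter_dvd_card_eq_div] at hinj
  have hdiv : (x + h) / p ≤ x / p + h / p + 1 := by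
    rw [Nat.add_div hp]
    split_ifs <;> omega
  have h1 : #((Icc 1 x).filter fun n => p ∣ n + h) ≤ x / p + 1 :=
    hinj.trans (Nat.sub_le_iff_le_add.mpr (by rwa [add_right_comm] at hdiv))
  calc (#((Icc 1 x).filter fun n => p ∣ n + h) : ℝ) ≤ ((x / p + 1 : ℕ) : ℝ) := by exact_mod_cast h1
    _ ≤ (x : ℝ) / p + 1 := by push_cast; gcongr; exact Nat.cast_div_le

/-- For fixed `d ≥ 1`, the `n ≤ x` with `d ∣ n + h` and `(n + h)/d` prime number at most
`π((x + h)/d)` (`n ↦ (n+h)/d` is injective into the primes `≤ (x+h)/d`). [folklore] -/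
theorem card_filter_dvd_prime_le (d x h : ℕ) :
    #((Icc 1 x).filter fun n => d ∣ n + h ∧ ((n + h) / d).Prime) ≤ Nat.primeCounting ((x + h) / d) := by
  classical
  rw [← Nat.primesLE_card_eq_primeCounting]
  refine Finset.card_le_card_of_injOn (fun n => (n + h) / d) (fun n hn => ?_) ?_
  · rw [Finset.mem_coe, mem_filter, mem_Icc] at hn
    rw [Finset.mem_coe, Nat.mem_primesLE]
    exact ⟨Nat.div_le_div_right (by omega), hn.2.2⟩
  · intro a ha b hb hab
    rw [Finset.mem_coe, mem_filter] at ha hb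
    have := Nat.eq_mul_of_div_eq_right ha.2.1 hab
    rw [Nat.mul_div_cancel' hb.2.1] at this
    omega

/-- **The count of §4 at `k = 0`.** For `R ≥ 1` and a shift `h ≤ x`:
`#{1 ≤ n ≤ x : λ(n+h) ≠ λ_Siegel(n+h)} ≤ ∑_{p* exceptional, R < p* ≤ x/R} (x/p* + 1)
+ ∑_{1 ≤ d ≤ 2R} π((x+h)/d)`: by Lemma 4.1 some exceptional `p* > R` divides `n + h ≤ 2x`; either
`p* ≤ x/R`, or `n + h = d p*` with `d < 2R` and `p*` prime.
[cite: TaoTeravainen2021, §4 (Lemma 4.1 and the reduction of Proposition 4.2 to (4.4), (4.5))] -/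
theorem card_filter_ne_le {q : ℕ} (χ : DirichletCharacter ℂ q) {R : ℝ} (hR : 1 ≤ R) (x h : ℕ)
    (hhx : h ≤ x) :
    (#((Icc 1 x).filter fun n =>
        (ArithmeticFunction.liouville (n + h) : ℝ) ≠ liouvilleSiegel χ R (n + h)) : ℝ) ≤
      ∑ p ∈ excPrimes χ (Ioc ⌊R⌋₊ ⌊(x : ℝ) / R⌋₊), ((x : ℝ) / p + 1) +
        ∑ d ∈ Icc 1 ⌊2 * R⌋₊, (Nat.primeCounting ((x + h) / d) : ℝ) := by
  classical
  have hR0 : 0 < R := by linarith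
  set Bad := (Icc 1 x).filter fun n =>
    (ArithmeticFunction.liouville (n + h) : ℝ) ≠ liouvilleSiegel χ R (n + h) with hBad
  set P₁ := excPrimes χ (Ioc ⌊R⌋₊ ⌊(x : ℝ) / R⌋₊) with hP₁
  set S₁ : ℕ → Finset ℕ := fun p => (Icc 1 x).filter fun n => p ∣ n + h with hS₁
  set S₂ : ℕ → Finset ℕ := fun d => (Icc 1 x).filter fun n => d ∣ n + h ∧ ((n + h) / d).Prime
    with hS₂
  -- the cover
  have hcover : Bad ⊆ P₁.biUnion S₁ ∪ (Icc 1 ⌊2 * R⌋₊).biUnion S₂ := by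
    intro n hn
    rw [hBad, mem_filter, mem_Icc] at hn
    obtain ⟨⟨hn1, hnx⟩, hne⟩ := hn
    obtain ⟨p, hp, hpn, hRp, hχ⟩ := exists_excPrime_of_ne χ R (by omega) hne
    have hp0 : (0 : ℝ) < p := by exact_mod_cast hp.pos
    have hx0 : (0 : ℝ) < x := by exact_mod_cast (show 0 < x by omega)
    rw [mem_union, mem_biUnion, mem_biUnion]
    by_cases hpx : (p : ℝ) ≤ (x : ℝ) / R
    · left
      refine ⟨p, ?_, ?_⟩
      · rw [hP₁, mem_excPrimes, mem_Ioc]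
        exact ⟨⟨(Nat.floor_lt hR0.le).mpr hRp, (Nat.le_floor_iff (by positivity)).mpr hpx⟩, hp, hχ⟩
      · rw [hS₁, mem_filter, mem_Icc]
        exact ⟨⟨hn1, hnx⟩, hpn⟩
    · right
      rw [not_le] at hpx
      obtain ⟨d, hd⟩ := hpn
      have hd0 : 0 < d := Nat.pos_of_ne_zero (by rintro rfl; omega)
      refine ⟨d, ?_, ?_⟩
      · rw [mem_Icc]
        refine ⟨hd0, (Nat.le_floor_iff (by positivity)).mpr ?_⟩
        -- `d = (n+h)/p ≤ 2x/p < 2R`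
        have hmul : (p : ℝ) * d = n + h := by exact_mod_cast hd.symm
        have hle : (p : ℝ) * d ≤ 2 * x := by
          rw [hmul]; exact_mod_cast (show n + h ≤ 2 * x by omega)
        have h1 : (x : ℝ) < p * R := by rwa [div_lt_iff₀ hR0] at hpx
        nlinarith
      · rw [hS₂, mem_filter, mem_Icc]
        refine ⟨⟨hn1, hnx⟩, ⟨p, by rw [hd, mul_comm]⟩, ?_⟩
        rw [hd, Nat.mul_div_cancel _ hd0]
        exact hp
  -- cardinalities
  have h1 : #Bad ≤ #(P₁.biUnion S₁) + #((Icc 1 ⌊2 * R⌋₊).biUnion S₂) :=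
    (card_le_card hcover).trans (card_union_le _ _)
  have h2 : #(P₁.biUnion S₁) ≤ ∑ p ∈ P₁, #(S₁ p) := card_biUnion_le
  have h3 : #((Icc 1 ⌊2 * R⌋₊).biUnion S₂) ≤ ∑ d ∈ Icc 1 ⌊2 * R⌋₊, #(S₂ d) := card_biUnion_le
  have h4 : ∀ p ∈ P₁, (#(S₁ p) : ℝ) ≤ (x : ℝ) / p + 1 := fun p hp =>
    card_filter_dvd_add_le p x h (mem_excPrimes.mp hp).2.1.pos
  have h5 : ∀ d ∈ Icc 1 ⌊2 * R⌋₊, (#(S₂ d) : ℝ) ≤ (Nat.primeCounting ((x + h) / d) : ℝ) :=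
    fun d _ => by exact_mod_cast card_filter_dvd_prime_le d x h
  calc (#Bad : ℝ) ≤ ((∑ p ∈ P₁, #(S₁ p) + ∑ d ∈ Icc 1 ⌊2 * R⌋₊, #(S₂ d) : ℕ) : ℝ) := by
        exact_mod_cast h1.trans (add_le_add h2 h3)
    _ = ∑ p ∈ P₁, (#(S₁ p) : ℝ) + ∑ d ∈ Icc 1 ⌊2 * R⌋₊, (#(S₂ d) : ℝ) := by
        rw [Nat.cast_add, Nat.cast_sum, Nat.cast_sum]
    _ ≤ _ := add_le_add (sum_le_sum h4) (sum_le_sum h5)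

end Literature.Barriers.Parity.TaoTeravainen
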